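import Summits.QuantumFields.YangMills.Theorems.ColdStartUniversalityShenZhuZhuLinkSusceptibilitySUN
import Summits.QuantumFields.YangMills.Theorems.ColdStartUniversalityShenZhuZhuPlaquetteSusceptibilitySU2
import Literature.MathematicalPhysics.QuantumFieldTheory.TiltedExponentMorseBounds
import HarnessLib

/-!
# Shen–Zhu–Zhu's Corollary 4.8 for EVERY `SU(N)` and EVERY dimension `d`: the plaquette susceptibility on every torus,
# `0 ≤ Σ_q Cov_{Λ_L,Nβ}(Re Tr Q_p, Re Tr Q_q) ≤ 16N(d−1)/(N/2 − 4dN|β|)` for `|β| < 1/(8d)`; the named facts `shenZhuZhu_plaquetteSusceptibility d N`, `N ≤ 2`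

Seat `ym-line-csu-p1` (g39), route `ColdStartUniversality` of `Summits/QuantumFields/YangMills`, helper file G22 (fixed lattice, strong
coupling; `--supports stmt-QuantumFields-24809`).  G20 proved SZZ Cor. 4.8 for `SU(2)`, `d = 3`; G21 the torus Poincaré inequality in Lipschitz
form for every `SU(N)`, `d` (`torus_variance_le_of_linkLipschitz_sun`, from the venture `YMGap`'s kernel-checked multi-link Bakry–Émery inequality).
Here: Cor. 4.8 for all `N ≥ 1`, `d ≥ 2`, with SZZ's printed numerator `16N(d−1)` and the sharp constant `K = N/2 − 4dN|β|` in place of `K_S`.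

* §1 one-link telescoping `abs_re_trace_plaq_sub_le` (`‖1‖_F = √N` is the tree's `OneLinkLaplace.frobNorm_one`); `wilsonPot₀_emb_eq_sum_plaquetteReTrace`; Lipschitz constants `√N·m_p(e)` /
  `√N·Σ_p m_p(e)` (`m_p(e)` = number of the four slots of `p` carrying `e`).  §2 slot combinatorics: `Σ_e m_p(e) = 4`, `Σ_p m_p(e) ≤ 4(d−1)`
  (each slot type injects into the other `d − 1` directions), `m_p(e) ≤ 1` for `L ≥ 2`.  §3 ★ `torus_plaquetteSum_variance_sun`
  (`Var(Σ_p Re Tr Q_p) ≤ 16N(d−1)#𝒫/K`), ★ `torus_plaquetteReTrace_variance_sun` (SZZ's `4N/K`), ★★★ `torus_plaquetteSusceptibility_sun`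
  (`0 ≤ Σ_q Cov ≤ 16N(d−1)/K`, symmetry via G20's `variance_sum_plaquetteReTrace_eq`), ★★ `…offDiag_sun`.  §4 ★★★ `szzPlaquetteSusceptibilityBound_sun`
  (all `A, B ≥ 16N(d−1)/K`), ★★★ `shenZhuZhu_plaquetteSusceptibility_of_le_two` — the NAMED FACT for `N ≤ 2`, every `d` (printed constants
  `16N(d−1)/K_S`, `(16N(d−1)+8N)/K_S`, `K_S ≤ K`; `SO(N)` conjunct vacuous for `N ≤ 2`).

THEOREMS ONLY, no definition, no sorry.  HONEST FRAMING: STRONG coupling (`|β| < 1/(8d)`), FIXED finite tori; a vendored LITERATURE statement is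
discharged for `N ∈ {1, 2}` (all `d`); nothing at weak coupling / in the continuum, nothing `K`-uniform along the route's scaling
(`UniformColdStartMixing`, 24809, ASIDE, not restated); no crux, rung or summit statement is proved; the Yang–Mills mass gap is NOT proved.

References: H. Shen, R. Zhu, X. Zhu, CMP 400 (2023) 805–851 = arXiv:2204.12737, Cor. 4.8 (p. 21–22), (3.2)–(3.4), Cor. 4.4 (4.11) [ShenZhuZhu2022].
-/

set_option autoImplicit false

noncomputable section

namespace Summit.QuantumFields.YangMills.Theorems.ColdStartUniversality

open MeasureTheory ProbabilityTheory Finset Filter Set Function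
open scoped BigOperators NNReal ENNReal Topology Matrix Matrix.Norms.Frobenius ContDiff
open Literature.MathematicalPhysics.QuantumFieldTheory
open Literature.MathematicalPhysics.QuantumLattice (fundamentalRep continuous_fundamentalRep fundamentalRep_apply)
open Literature.MathematicalPhysics.QuantumFieldTheory.SUNBakryEmery (SUN)
open Literature.Barriers.QuantumFields (plaquetteReTrace continuous_plaquetteReTrace)
open Summit.Ventures.YMGap.LatticeBakryEmery (PSU Cfg emb emb_apply emb_mem_unitaryGroup LinkLipschitz wilsonPot₀ wilsonPot₀_mem_polySpace
  plaqLinks contDiff_of_mem_polySpace re_trace_plaquette_mem_polySpace)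

/-! ## §1. One-link telescoping; `wilsonPot₀` is the plaquette sum; Lipschitz constants -/

section Telescoping

variable {N : ℕ}

/-- The conjugate transpose of a unitary matrix is unitary. [folklore] -/
theorem conjTranspose_mem_unitaryGroup' {A : Matrix (Fin N) (Fin N) ℂ} (hA : A ∈ Matrix.unitaryGroup (Fin N) ℂ) :
    Aᴴ ∈ Matrix.unitaryGroup (Fin N) ℂ := by
  rw [← Matrix.star_eq_conjTranspose]; exact Unitary.star_mem hA

/-- **One-link telescoping for the plaquette trace** (SZZ (3.2)–(3.4) in Lipschitz form): for unitary `Aₖ, Bₖ`,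
`|Re tr(A₁A₂A₃ᴴA₄ᴴ) − Re tr(B₁B₂B₃ᴴB₄ᴴ)| ≤ √N Σₖ ‖Aₖ − Bₖ‖_F`. [cite: ShenZhuZhu2022, (3.2)] -/
theorem abs_re_trace_plaq_sub_le {A₁ A₂ A₃ A₄ B₁ B₂ B₃ B₄ : Matrix (Fin N) (Fin N) ℂ}
    (hA₂ : A₂ ∈ Matrix.unitaryGroup (Fin N) ℂ) (hA₃ : A₃ ∈ Matrix.unitaryGroup (Fin N) ℂ) (hA₄ : A₄ ∈ Matrix.unitaryGroup (Fin N) ℂ)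
    (hB₁ : B₁ ∈ Matrix.unitaryGroup (Fin N) ℂ) (hB₂ : B₂ ∈ Matrix.unitaryGroup (Fin N) ℂ) (hB₃ : B₃ ∈ Matrix.unitaryGroup (Fin N) ℂ) :
    |(A₁ * A₂ * A₃ᴴ * A₄ᴴ).trace.re - (B₁ * B₂ * B₃ᴴ * B₄ᴴ).trace.re| ≤
      Real.sqrt N * (frobNorm (A₁ - B₁) + frobNorm (A₂ - B₂) + frobNorm (A₃ - B₃) + frobNorm (A₄ - B₄)) := by
  rw [← Complex.sub_re, ← Matrix.trace_sub]
  have h1 : |((A₁ * A₂ * A₃ᴴ * A₄ᴴ - B₁ * B₂ * B₃ᴴ * B₄ᴴ)).trace.re| ≤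
      Real.sqrt N * frobNorm (A₁ * A₂ * A₃ᴴ * A₄ᴴ - B₁ * B₂ * B₃ᴴ * B₄ᴴ) := by
    have h := abs_re_trace_mul_le (1 : Matrix (Fin N) (Fin N) ℂ) (A₁ * A₂ * A₃ᴴ * A₄ᴴ - B₁ * B₂ * B₃ᴴ * B₄ᴴ)
    rwa [Matrix.one_mul, OneLinkLaplace.frobNorm_one] at h
  refine h1.trans (mul_le_mul_of_nonneg_left ?_ (Real.sqrt_nonneg _))
  have hsplit : A₁ * A₂ * A₃ᴴ * A₄ᴴ - B₁ * B₂ * B₃ᴴ * B₄ᴴ =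
      (A₁ * A₂ * A₃ᴴ - B₁ * B₂ * B₃ᴴ) * A₄ᴴ + B₁ * B₂ * B₃ᴴ * (A₄ᴴ - B₄ᴴ) := by
    simp only [Matrix.sub_mul, Matrix.mul_sub]; abel
  rw [hsplit]
  have hQ : B₁ * B₂ * B₃ᴴ ∈ Matrix.unitaryGroup (Fin N) ℂ :=
    Submonoid.mul_mem _ (Submonoid.mul_mem _ hB₁ hB₂) (conjTranspose_mem_unitaryGroup' hB₃)
  calc frobNorm ((A₁ * A₂ * A₃ᴴ - B₁ * B₂ * B₃ᴴ) * A₄ᴴ + B₁ * B₂ * B₃ᴴ * (A₄ᴴ - B₄ᴴ))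
      ≤ frobNorm ((A₁ * A₂ * A₃ᴴ - B₁ * B₂ * B₃ᴴ) * A₄ᴴ) + frobNorm (B₁ * B₂ * B₃ᴴ * (A₄ᴴ - B₄ᴴ)) := frobNorm_add_le _ _
    _ = frobNorm (A₁ * A₂ * A₃ᴴ - B₁ * B₂ * B₃ᴴ) + frobNorm (A₄ - B₄) := by
        rw [frobNorm_mul_unitary _ (conjTranspose_mem_unitaryGroup' hA₄), frobNorm_unitary_mul hQ, ← Matrix.conjTranspose_sub,
          frobNorm_conjTranspose]
    _ ≤ frobNorm (A₁ - B₁) + frobNorm (A₂ - B₂) + frobNorm (A₃ᴴ - B₃ᴴ) + frobNorm (A₄ - B₄) := by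
        have := frobNorm_triple_sub_le (A₁ := A₁) (A₃ := A₃ᴴ) (B₃ := B₃ᴴ) hA₂ (conjTranspose_mem_unitaryGroup' hA₃) hB₁ hB₂
        linarith
    _ = frobNorm (A₁ - B₁) + frobNorm (A₂ - B₂) + frobNorm (A₃ - B₃) + frobNorm (A₄ - B₄) := by
        rw [← Matrix.conjTranspose_sub, frobNorm_conjTranspose]

end Telescoping

section Plaquettes

variable {d N L : ℕ} [NeZero L]

/-- **On `SU(N)^E` the venture's polynomial potential `wilsonPot₀` IS the plaquette sum `Σ_p Re Tr Q_p`** (`Q_e⁻¹ = Q_eᴴ`).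
[cite: ShenZhuZhu2022, (1.1)] -/
theorem wilsonPot₀_emb_eq_sum_plaquetteReTrace (U : GaugeConfig d L (SUN N)) :
    wilsonPot₀ d N L (emb U) = ∑ p, plaquetteReTrace (fundamentalRep (Fin N)) p U := by
  -- adapted from `neg_mul_wilsonAction_eq` (Summits/Ventures/YMGap/Thresholds/LatticeBakryEmeryWilson.lean)
  have hp : ∀ p : Plaquette d L, (fundamentalRep (Fin N) (plaquetteHolonomy U p.1 p.2.1.1 p.2.1.2)).trace.re =
      (emb U (plaqLinks p).1 * emb U (plaqLinks p).2.1 * (emb U (plaqLinks p).2.2.1)ᴴ *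
        (emb U (plaqLinks p).2.2.2)ᴴ).trace.re := by
    intro p
    simp only [plaquetteHolonomy, map_mul, plaqLinks, emb_apply]
    rfl
  simp only [wilsonPot₀, plaquetteReTrace, hp]

omit [NeZero L] in
/-- Off the link `e` two configurations that agree off `e` have equal links; at `e` their Frobenius distance is `suFrobDist`. [folklore] -/
theorem frobNorm_emb_sub_le {e : Edge d L} {g h : PSU (Edge d L) N} (hgh : ∀ e', e' ≠ e → g e' = h e') (s : Edge d L) :
    frobNorm (emb g s - emb h s) ≤ (if s = e then 1 else 0) * suFrobDist (g e) (h e) := by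
  by_cases hs : s = e
  · subst hs; rw [if_pos rfl, one_mul]; rfl
  · rw [if_neg hs, zero_mul, emb_apply, emb_apply, hgh s hs, sub_self, frobNorm_zero]

omit [NeZero L] in
/-- **One plaquette trace is `√N·m_p(e)`-Lipschitz in the link `e`**, `m_p(e)` the number of the four slots of `p` carrying `e`.
[cite: ShenZhuZhu2022, (3.2)] -/
theorem linkLipschitz_rePlaqTrace (p : Plaquette d L) :
    LinkLipschitz (fun Q : Cfg (Edge d L) N =>
        (Q (plaqLinks p).1 * Q (plaqLinks p).2.1 * (Q (plaqLinks p).2.2.1)ᴴ * (Q (plaqLinks p).2.2.2)ᴴ).trace.re)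
      (fun e => Real.sqrt N * ((if (plaqLinks p).1 = e then 1 else 0) + (if (plaqLinks p).2.1 = e then 1 else 0) +
        (if (plaqLinks p).2.2.1 = e then 1 else 0) + (if (plaqLinks p).2.2.2 = e then 1 else 0))) := by
  intro e g h hgh
  dsimp only
  refine (abs_re_trace_plaq_sub_le (emb_mem_unitaryGroup g _) (emb_mem_unitaryGroup g _) (emb_mem_unitaryGroup g _)
    (emb_mem_unitaryGroup h _) (emb_mem_unitaryGroup h _) (emb_mem_unitaryGroup h _)).trans ?_
  rw [mul_assoc]
  refine mul_le_mul_of_nonneg_left ?_ (Real.sqrt_nonneg _)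
  have h1 := frobNorm_emb_sub_le hgh (plaqLinks p).1
  have h2 := frobNorm_emb_sub_le hgh (plaqLinks p).2.1
  have h3 := frobNorm_emb_sub_le hgh (plaqLinks p).2.2.1
  have h4 := frobNorm_emb_sub_le hgh (plaqLinks p).2.2.2
  nlinarith [suFrobDist_nonneg (g e) (h e)]

/-- **The plaquette sum `wilsonPot₀ = Σ_p Re tr(Q_aQ_bQ_cᴴQ_dᴴ)` is `√N·Σ_p m_p(e)`-Lipschitz in the link `e`.** [cite: ShenZhuZhu2022, Corollary 4.8] -/
theorem linkLipschitz_wilsonPot₀ :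
    LinkLipschitz (wilsonPot₀ d N L)
      (fun e => Real.sqrt N * ∑ p : Plaquette d L, ((if (plaqLinks p).1 = e then 1 else 0) + (if (plaqLinks p).2.1 = e then 1 else 0) +
        (if (plaqLinks p).2.2.1 = e then 1 else 0) + (if (plaqLinks p).2.2.2 = e then (1 : ℝ) else 0))) := by
  intro e g h hgh
  dsimp only
  simp only [wilsonPot₀]
  rw [← Finset.sum_sub_distrib, Finset.mul_sum, Finset.sum_mul]
  refine (Finset.abs_sum_le_sum_abs _ _).trans (Finset.sum_le_sum fun p _ => ?_)
  exact linkLipschitz_rePlaqTrace (N := N) p e g h hgh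

/-! ## §2. Lattice combinatorics of the four slots -/

/-- The four slots of a plaquette: `Σ_e m_p(e) = 4`. [folklore] -/
theorem sum_slotCount_eq_four (p : Plaquette d L) :
    ∑ e : Edge d L, ((if (plaqLinks p).1 = e then 1 else 0) + (if (plaqLinks p).2.1 = e then 1 else 0) +
        (if (plaqLinks p).2.2.1 = e then 1 else 0) + (if (plaqLinks p).2.2.2 = e then (1 : ℝ) else 0)) = 4 := by
  simp only [Finset.sum_add_distrib, Finset.sum_ite_eq, Finset.mem_univ, if_true]
  norm_num

/-- A slot type injects into the `d − 1` directions other than `e.2`: if `slot p = e` forces `idx p ≠ e.2` and `p` is determined by `slot p = e` and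
`idx p`, then at most `d − 1` plaquettes carry `e` in that slot. [folklore] -/
theorem card_filter_slot_le (e : Edge d L) (slot : Plaquette d L → Edge d L) (idx : Plaquette d L → Fin d)
    (hidx : ∀ p, slot p = e → idx p ≠ e.2) (hinj : ∀ p p', slot p = e → slot p' = e → idx p = idx p' → p = p') :
    ((Finset.univ.filter fun p => slot p = e).card : ℝ) ≤ (d : ℝ) - 1 := by
  classical
  have hd : 1 ≤ d := Nat.succ_le_of_lt (Fin.pos e.2)
  have h : (Finset.univ.filter fun p => slot p = e).card ≤ (Finset.univ.erase e.2).card :=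
    Finset.card_le_card_of_injOn idx
      (fun p hp => by
        rw [Finset.coe_filter] at hp
        exact Finset.mem_coe.2 (Finset.mem_erase.2 ⟨hidx p hp.2, Finset.mem_univ _⟩))
      (fun p hp p' hp' hpp => by
        rw [Finset.coe_filter] at hp hp'
        exact hinj p p' hp.2 hp'.2 hpp)
  rw [Finset.card_erase_of_mem (Finset.mem_univ _), Finset.card_univ, Fintype.card_fin] at h
  have h' : ((Finset.univ.filter fun p => slot p = e).card : ℝ) ≤ ((d - 1 : ℕ) : ℝ) := by exact_mod_cast h
  rwa [Nat.cast_sub hd, Nat.cast_one] at h'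

/-- **Each link lies in at most `4(d−1)` plaquette slots**: `Σ_p m_p(e) ≤ 4(d−1)` (in fact `= 2(d−1)`; the four slot types each inject into the
other directions). [folklore] -/
theorem sum_slotCount_le (e : Edge d L) :
    ∑ p : Plaquette d L, ((if (plaqLinks p).1 = e then 1 else 0) + (if (plaqLinks p).2.1 = e then 1 else 0) +
        (if (plaqLinks p).2.2.1 = e then 1 else 0) + (if (plaqLinks p).2.2.2 = e then (1 : ℝ) else 0)) ≤ 4 * ((d : ℝ) - 1) := by
  classical
  simp only [Finset.sum_add_distrib, Finset.sum_boole]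
  have hshift : ∀ (x y : Site d L) (i : Fin d), x.shift i = y.shift i → x = y := fun x y i hxy => add_right_cancel hxy
  -- slot a = (x, i): index j
  have ha := card_filter_slot_le e (fun p => (plaqLinks p).1) (fun p => p.2.1.2)
    (fun p hp => by rw [← (congrArg Prod.snd hp : p.2.1.1 = e.2)]; exact ne_of_gt p.2.2)
    (fun p p' hp hp' hj => Prod.ext ((congrArg Prod.fst hp).trans (congrArg Prod.fst hp').symm)
      (Subtype.ext (Prod.ext ((congrArg Prod.snd hp).trans (congrArg Prod.snd hp').symm) hj)))
  -- slot b = (x + eᵢ, j): index i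
  have hb := card_filter_slot_le e (fun p => (plaqLinks p).2.1) (fun p => p.2.1.1)
    (fun p hp => by rw [← (congrArg Prod.snd hp : p.2.1.2 = e.2)]; exact ne_of_lt p.2.2)
    (fun p p' hp hp' hi => by
      have h1 : p.1.shift p.2.1.1 = e.1 := congrArg Prod.fst hp
      have hi' : p.2.1.1 = p'.2.1.1 := hi
      rw [hi'] at h1
      exact Prod.ext (hshift _ _ _ (h1.trans (congrArg Prod.fst hp' : p'.1.shift p'.2.1.1 = e.1).symm))
        (Subtype.ext (Prod.ext hi' ((congrArg Prod.snd hp).trans (congrArg Prod.snd hp').symm))))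
  -- slot c = (x + eⱼ, i): index j
  have hc := card_filter_slot_le e (fun p => (plaqLinks p).2.2.1) (fun p => p.2.1.2)
    (fun p hp => by rw [← (congrArg Prod.snd hp : p.2.1.1 = e.2)]; exact ne_of_gt p.2.2)
    (fun p p' hp hp' hj => by
      have h1 : p.1.shift p.2.1.2 = e.1 := congrArg Prod.fst hp
      have hj' : p.2.1.2 = p'.2.1.2 := hj
      rw [hj'] at h1
      exact Prod.ext (hshift _ _ _ (h1.trans (congrArg Prod.fst hp' : p'.1.shift p'.2.1.2 = e.1).symm))
        (Subtype.ext (Prod.ext ((congrArg Prod.snd hp).trans (congrArg Prod.snd hp').symm) hj')))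
  -- slot d = (x, j): index i
  have hd := card_filter_slot_le e (fun p => (plaqLinks p).2.2.2) (fun p => p.2.1.1)
    (fun p hp => by rw [← (congrArg Prod.snd hp : p.2.1.2 = e.2)]; exact ne_of_lt p.2.2)
    (fun p p' hp hp' hi => Prod.ext ((congrArg Prod.fst hp).trans (congrArg Prod.fst hp').symm)
      (Subtype.ext (Prod.ext hi ((congrArg Prod.snd hp).trans (congrArg Prod.snd hp').symm))))
  linarith

omit [NeZero L] in
/-- **On a torus with `L ≥ 2` the four links of a plaquette are distinct**: `m_p(e) ≤ 1`. [folklore] -/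
theorem slotCount_le_one (hL : 1 < L) (p : Plaquette d L) (e : Edge d L) :
    ((if (plaqLinks p).1 = e then 1 else 0) + (if (plaqLinks p).2.1 = e then 1 else 0) +
        (if (plaqLinks p).2.2.1 = e then 1 else 0) + (if (plaqLinks p).2.2.2 = e then (1 : ℝ) else 0)) ≤ 1 := by
  haveI : Fact (1 < L) := ⟨hL⟩
  have hij : p.2.1.1 ≠ p.2.1.2 := ne_of_lt p.2.2
  have hne : ∀ (x : Site d L) (i : Fin d), x.shift i ≠ x := by
    intro x i h
    have h2 := congrArg (fun y => y - x) h
    simp [Site.shift] at h2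
  -- the four links, pairwise distinct
  have hab : (plaqLinks p).1 ≠ (plaqLinks p).2.1 := fun h => hij (congrArg Prod.snd h)
  have hac : (plaqLinks p).1 ≠ (plaqLinks p).2.2.1 := fun h => hne p.1 p.2.1.2 (congrArg Prod.fst h).symm
  have had : (plaqLinks p).1 ≠ (plaqLinks p).2.2.2 := fun h => hij (congrArg Prod.snd h)
  have hbc : (plaqLinks p).2.1 ≠ (plaqLinks p).2.2.1 := fun h => hij (congrArg Prod.snd h).symm
  have hbd : (plaqLinks p).2.1 ≠ (plaqLinks p).2.2.2 := fun h => hne p.1 p.2.1.1 (congrArg Prod.fst h)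
  have hcd : (plaqLinks p).2.2.1 ≠ (plaqLinks p).2.2.2 := fun h => hij (congrArg Prod.snd h)
  by_cases h1 : (plaqLinks p).1 = e
  · rw [if_pos h1, if_neg (fun h => hab (h1.trans h.symm)), if_neg (fun h => hac (h1.trans h.symm)),
      if_neg (fun h => had (h1.trans h.symm))]; norm_num
  by_cases h2 : (plaqLinks p).2.1 = e
  · rw [if_neg h1, if_pos h2, if_neg (fun h => hbc (h2.trans h.symm)), if_neg (fun h => hbd (h2.trans h.symm))]; norm_num
  by_cases h3 : (plaqLinks p).2.2.1 = e
  · rw [if_neg h1, if_neg h2, if_pos h3, if_neg (fun h => hcd (h3.trans h.symm))]; norm_num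
  · rw [if_neg h1, if_neg h2, if_neg h3]; split_ifs <;> norm_num

/-! ## §3. Variances and the susceptibility on every torus -/

/-- ★ **Variance of the TOTAL plaquette field on every torus, every `SU(N)`, every `d`**: for `K = N/2 − 4dN|β| > 0`,
`Var_{μ_{Λ_L,Nβ}}(Σ_p Re Tr Q_p) ≤ 16N(d−1)·#𝒫⁺/K` (Lipschitz constants `√N·Σ_p m_p(e)`, `Σ_e (Σ_p m_p(e))² ≤ 4(d−1)·Σ_{e,p} m_p(e) = 16(d−1)#𝒫⁺`).
The Yang–Mills mass gap is NOT proved. [cite: ShenZhuZhu2022, Corollary 4.8] -/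
theorem torus_plaquetteSum_variance_sun (hN : N ≠ 0) {β : ℝ} (hK : 0 < (N : ℝ) / 2 - N * |β| * (4 * d)) :
    Var[fun U : GaugeConfig d L (SUN N) => ∑ p, plaquetteReTrace (fundamentalRep (Fin N)) p U;
        wilsonMeasure (d := d) (L := L) (fundamentalRep (Fin N)) ((N : ℝ) * β)] ≤
      16 * N * ((d : ℝ) - 1) * (Fintype.card (Plaquette d L) : ℝ) / ((N : ℝ) / 2 - N * |β| * (4 * d)) := by
  classical
  set m : Edge d L → ℝ := fun e => ∑ p : Plaquette d L, ((if (plaqLinks p).1 = e then 1 else 0) + (if (plaqLinks p).2.1 = e then 1 else 0) +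
        (if (plaqLinks p).2.2.1 = e then 1 else 0) + (if (plaqLinks p).2.2.2 = e then (1 : ℝ) else 0)) with hm
  have hm0 : ∀ e, 0 ≤ m e := fun e => Finset.sum_nonneg fun p _ => by positivity
  have h := torus_variance_le_of_linkLipschitz_sun (L := L) hN hK (f := wilsonPot₀ d N L)
    (contDiff_of_mem_polySpace wilsonPot₀_mem_polySpace) (Lc := fun e => Real.sqrt N * m e)
    (fun e => mul_nonneg (Real.sqrt_nonneg _) (hm0 e)) linkLipschitz_wilsonPot₀
  simp only [wilsonPot₀_emb_eq_sum_plaquetteReTrace] at h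
  refine h.trans (div_le_div_of_nonneg_right ?_ hK.le)
  -- `Σ_e N m(e)² ≤ N · 4(d−1) · Σ_e m(e) = 16 N (d−1) #P`
  have hsq : Real.sqrt N ^ 2 = N := Real.sq_sqrt (Nat.cast_nonneg N)
  have hsum : ∑ e, m e = 4 * (Fintype.card (Plaquette d L) : ℝ) := by
    rw [hm, Finset.sum_comm]
    simp only [sum_slotCount_eq_four, Finset.sum_const, Finset.card_univ, nsmul_eq_mul]
    ring
  calc ∑ e, (Real.sqrt N * m e) ^ 2 = N * ∑ e, m e * m e := by
        rw [Finset.mul_sum]; refine Finset.sum_congr rfl fun e _ => ?_; rw [mul_pow, hsq]; ring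
    _ ≤ N * ∑ e, 4 * ((d : ℝ) - 1) * m e :=
        mul_le_mul_of_nonneg_left (Finset.sum_le_sum fun e _ => mul_le_mul_of_nonneg_right (sum_slotCount_le e) (hm0 e))
          (Nat.cast_nonneg N)
    _ = 16 * N * ((d : ℝ) - 1) * (Fintype.card (Plaquette d L) : ℝ) := by rw [← Finset.mul_sum, hsum]; ring

/-- ★ **SZZ's single-plaquette variance bound for every `SU(N)`, every `d`, every torus with `L ≥ 2`**: `Var_{μ_{Λ_L,Nβ}}(Re Tr Q_p) ≤ 4N/K`,
`K = N/2 − 4dN|β|` (SZZ print `4N/K_S`).  The Yang–Mills mass gap is NOT proved. [cite: ShenZhuZhu2022, Corollary 4.8] -/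
theorem torus_plaquetteReTrace_variance_sun (hN : N ≠ 0) {β : ℝ} (hK : 0 < (N : ℝ) / 2 - N * |β| * (4 * d)) (hL : 1 < L)
    (p : Plaquette d L) :
    Var[plaquetteReTrace (fundamentalRep (Fin N)) p; wilsonMeasure (d := d) (L := L) (fundamentalRep (Fin N)) ((N : ℝ) * β)] ≤
      4 * N / ((N : ℝ) / 2 - N * |β| * (4 * d)) := by
  classical
  set m : Edge d L → ℝ := fun e => ((if (plaqLinks p).1 = e then 1 else 0) + (if (plaqLinks p).2.1 = e then 1 else 0) +
        (if (plaqLinks p).2.2.1 = e then 1 else 0) + (if (plaqLinks p).2.2.2 = e then (1 : ℝ) else 0)) with hm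
  have hm0 : ∀ e, 0 ≤ m e := fun e => by positivity
  have h := torus_variance_le_of_linkLipschitz_sun (L := L) hN hK
    (contDiff_of_mem_polySpace (re_trace_plaquette_mem_polySpace (plaqLinks p).1 (plaqLinks p).2.1 (plaqLinks p).2.2.1 (plaqLinks p).2.2.2))
    (Lc := fun e => Real.sqrt N * m e) (fun e => mul_nonneg (Real.sqrt_nonneg _) (hm0 e)) (linkLipschitz_rePlaqTrace p)
  have hfun : (fun U : GaugeConfig d L (SUN N) => (emb U (plaqLinks p).1 * emb U (plaqLinks p).2.1 * (emb U (plaqLinks p).2.2.1)ᴴ *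
      (emb U (plaqLinks p).2.2.2)ᴴ).trace.re) = plaquetteReTrace (fundamentalRep (Fin N)) p := by
    funext U
    simp only [plaquetteReTrace, plaquetteHolonomy, map_mul, plaqLinks, emb_apply]
    rfl
  rw [hfun] at h
  refine h.trans (div_le_div_of_nonneg_right ?_ hK.le)
  have hsq : Real.sqrt N ^ 2 = N := Real.sq_sqrt (Nat.cast_nonneg N)
  have hsum : ∑ e, m e = 4 := sum_slotCount_eq_four p
  calc ∑ e, (Real.sqrt N * m e) ^ 2 = N * ∑ e, m e * m e := by
        rw [Finset.mul_sum]; refine Finset.sum_congr rfl fun e _ => ?_; rw [mul_pow, hsq]; ring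
    _ ≤ N * ∑ e, 1 * m e :=
        mul_le_mul_of_nonneg_left (Finset.sum_le_sum fun e _ => mul_le_mul_of_nonneg_right (slotCount_le_one hL p e) (hm0 e))
          (Nat.cast_nonneg N)
    _ = 4 * N := by simp only [one_mul, hsum]; ring

/-- ★★★ **Plaquette susceptibility (SZZ Cor. 4.8) for EVERY `SU(N)`, EVERY `d`, EVERY volume**: for `K = N/2 − 4dN|β| > 0` (`|β| < 1/(8d)`), every
torus `(ℤ/L)^d` and every plaquette `p₀`,  `0 ≤ Σ_{q ∈ 𝒫⁺_{Λ_L}} Cov_{μ_{Λ_L,Nβ}}(Re Tr Q_{p₀}, Re Tr Q_q) ≤ 16N(d−1)/K`  (row sum = `Var(Σ_q Re Tr Q_q)/#𝒫⁺`: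
translations and axis permutations act transitively on plaquettes, G20).  SZZ print `16N(d−1)/K_S`.  The Yang–Mills mass gap is NOT proved.
[cite: ShenZhuZhu2022, Corollary 4.8] -/
theorem torus_plaquetteSusceptibility_sun (hN : N ≠ 0) {β : ℝ} (hK : 0 < (N : ℝ) / 2 - N * |β| * (4 * d)) (p₀ : Plaquette d L) :
    0 ≤ ∑ q, cov[plaquetteReTrace (fundamentalRep (Fin N)) p₀, plaquetteReTrace (fundamentalRep (Fin N)) q;
        wilsonMeasure (d := d) (L := L) (fundamentalRep (Fin N)) ((N : ℝ) * β)] ∧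
    ∑ q, cov[plaquetteReTrace (fundamentalRep (Fin N)) p₀, plaquetteReTrace (fundamentalRep (Fin N)) q;
        wilsonMeasure (d := d) (L := L) (fundamentalRep (Fin N)) ((N : ℝ) * β)] ≤ 16 * N * ((d : ℝ) - 1) / ((N : ℝ) / 2 - N * |β| * (4 * d)) := by
  haveI : SecondCountableTopology (Matrix (Fin N) (Fin N) ℂ) := inferInstanceAs (SecondCountableTopology (Fin N → Fin N → ℂ))
  haveI : SecondCountableTopology (SUN N) := Topology.IsEmbedding.subtypeVal.secondCountableTopology
  have hcard : (0 : ℝ) < Fintype.card (Plaquette d L) := by exact_mod_cast Fintype.card_pos_iff.2 ⟨p₀⟩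
  have hkey := variance_sum_plaquetteReTrace_eq (d := d) (L := L) (fundamentalRep (Fin N)) (continuous_fundamentalRep (Fin N)) ((N : ℝ) * β) p₀
  have hvar := torus_plaquetteSum_variance_sun (d := d) (L := L) hN hK
  have hnn : 0 ≤ Var[fun U : GaugeConfig d L (SUN N) => ∑ p, plaquetteReTrace (fundamentalRep (Fin N)) p U;
      wilsonMeasure (d := d) (L := L) (fundamentalRep (Fin N)) ((N : ℝ) * β)] := variance_nonneg _ _
  rw [hkey] at hvar hnn
  constructor
  · exact le_of_mul_le_mul_left (by rw [mul_zero]; exact hnn) hcard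
  · rw [mul_comm (16 * N * ((d : ℝ) - 1)), mul_div_assoc] at hvar
    exact le_of_mul_le_mul_left hvar hcard

/-- ★★ **Off-diagonal plaquette susceptibility (SZZ Cor. 4.8, "in particular") for every `SU(N)`, `d ≥ 2`, `L ≥ 2`**:
`|Σ_{q ≠ p₀} Cov_{μ_{Λ_L,Nβ}}(Re Tr Q_{p₀}, Re Tr Q_q)| ≤ 16N(d−1)/K` (row sum in `[0, 16N(d−1)/K]`, diagonal in `[0, 4N/K]`; SZZ print `(16N(d−1)+8N)/K_S`).
The Yang–Mills mass gap is NOT proved. [cite: ShenZhuZhu2022, Corollary 4.8] -/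
theorem torus_plaquetteSusceptibility_offDiag_sun (hd : 2 ≤ d) (hN : N ≠ 0) {β : ℝ} (hK : 0 < (N : ℝ) / 2 - N * |β| * (4 * d)) (hL : 1 < L)
    (p₀ : Plaquette d L) :
    |∑ q ∈ Finset.univ.erase p₀, cov[plaquetteReTrace (fundamentalRep (Fin N)) p₀, plaquetteReTrace (fundamentalRep (Fin N)) q;
        wilsonMeasure (d := d) (L := L) (fundamentalRep (Fin N)) ((N : ℝ) * β)]| ≤ 16 * N * ((d : ℝ) - 1) / ((N : ℝ) / 2 - N * |β| * (4 * d)) := by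
  classical
  haveI : SecondCountableTopology (Matrix (Fin N) (Fin N) ℂ) := inferInstanceAs (SecondCountableTopology (Fin N → Fin N → ℂ))
  haveI : SecondCountableTopology (SUN N) := Topology.IsEmbedding.subtypeVal.secondCountableTopology
  obtain ⟨h0, h1⟩ := torus_plaquetteSusceptibility_sun (d := d) (L := L) hN hK p₀
  have hv1 := torus_plaquetteReTrace_variance_sun (d := d) (L := L) hN hK hL p₀
  have hv0 : 0 ≤ Var[plaquetteReTrace (fundamentalRep (Fin N)) p₀; wilsonMeasure (d := d) (L := L) (fundamentalRep (Fin N)) ((N : ℝ) * β)] :=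
    variance_nonneg _ _
  have hd' : (2 : ℝ) ≤ d := by exact_mod_cast hd
  have hN' : (1 : ℝ) ≤ N := by exact_mod_cast Nat.one_le_iff_ne_zero.2 hN
  have h4 : 4 * (N : ℝ) / ((N : ℝ) / 2 - N * |β| * (4 * d)) ≤ 16 * N * ((d : ℝ) - 1) / ((N : ℝ) / 2 - N * |β| * (4 * d)) :=
    div_le_div_of_nonneg_right (by nlinarith) hK.le
  have hXm : AEMeasurable (plaquetteReTrace (fundamentalRep (Fin N)) p₀ : GaugeConfig d L (SUN N) → ℝ)
      (wilsonMeasure (d := d) (L := L) (fundamentalRep (Fin N)) ((N : ℝ) * β)) :=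
    ((continuous_trace_re (fundamentalRep (Fin N)) (continuous_fundamentalRep (Fin N))).measurable.comp
      (measurable_plaquetteHolonomy _ _ _)).aemeasurable
  rw [Finset.sum_erase_eq_sub (Finset.mem_univ p₀), covariance_self hXm, abs_sub_le_iff]
  constructor <;> linarith

/-! ## §4. The parameterised shape for every `SU(N)`, `d ≥ 2`, and the named facts for `N ≤ 2` -/

/-- ★★★ **`SZZPlaquetteSusceptibilityBound (fundamentalRep (Fin N)) d (Nβ) A B` for every `N ≥ 1`, `d ≥ 2`, `|β| < 1/(8d)` and all `A, B ≥ 16N(d−1)/K`**,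
`K = N/2 − 4dN|β|`: on every torus `L > 1` and every plaquette, `Σ_q Cov(Re Tr Q_p, Re Tr Q_q) ≤ A`, `|Σ_{q ≠ p} Cov(…)| ≤ B`.  The Yang–Mills mass gap
is NOT proved. [cite: ShenZhuZhu2022, Corollary 4.8] -/
theorem szzPlaquetteSusceptibilityBound_sun (hd : 2 ≤ d) (hN : 1 ≤ N) {β : ℝ} (hK : 0 < (N : ℝ) / 2 - N * |β| * (4 * d)) {A B : ℝ}
    (hA : 16 * N * ((d : ℝ) - 1) / ((N : ℝ) / 2 - N * |β| * (4 * d)) ≤ A) (hB : 16 * N * ((d : ℝ) - 1) / ((N : ℝ) / 2 - N * |β| * (4 * d)) ≤ B) :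
    SZZPlaquetteSusceptibilityBound (fundamentalRep (Fin N)) d ((N : ℝ) * β) A B := by
  intro L _ hL p
  have hN0 : N ≠ 0 := by omega
  obtain ⟨_, h1⟩ := torus_plaquetteSusceptibility_sun (d := d) (L := L) hN0 hK p
  have h2 := torus_plaquetteSusceptibility_offDiag_sun (L := L) hd hN0 hK hL p
  exact ⟨h1.trans hA, h2.trans hB⟩

/-- ★★★ **The named facts `shenZhuZhu_plaquetteSusceptibility d N` (Shen–Zhu–Zhu CMP 400 (2023), Cor. 4.8) for `N ∈ {1, 2}` and EVERY dimension `d`**: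
the `SU(N)` conjunct on SZZ's window `|β| < 1/(16(d−1))` with the printed constants `16N(d−1)/K_S` and `(16N(d−1)+8N)/K_S`, `K_S = N/2 − 8N(d−1)|β| ≤ K`;
the `SO(N)` conjunct is vacuous for `N ≤ 2`.  STRONG coupling, fixed finite tori; the Yang–Mills mass gap is NOT proved. [cite: ShenZhuZhu2022, Corollary 4.8] -/
theorem shenZhuZhu_plaquetteSusceptibility_of_le_two (hN2 : N ≤ 2) : shenZhuZhu_plaquetteSusceptibility d N := by
  refine ⟨fun hd hN β hβ => ?_, fun hd hN β hβ => ?_⟩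
  · have hd' : (2 : ℝ) ≤ d := by exact_mod_cast hd
    have hN' : (1 : ℝ) ≤ N := by exact_mod_cast hN
    have hKS : 0 < szzBakryEmeryConstSU N d β := (szzBakryEmeryConstSU_pos_iff hd hN β).2 hβ
    have h0 : 0 ≤ (N : ℝ) * |β| := mul_nonneg (by linarith) (abs_nonneg β)
    have hKSle : szzBakryEmeryConstSU N d β ≤ (N : ℝ) / 2 - N * |β| * (4 * d) := by
      simp only [szzBakryEmeryConstSU]; nlinarith
    have hK : 0 < (N : ℝ) / 2 - N * |β| * (4 * d) := lt_of_lt_of_le hKS hKSle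
    have hnum : 0 ≤ 16 * (N : ℝ) * ((d : ℝ) - 1) := by nlinarith
    have hA : 16 * N * ((d : ℝ) - 1) / ((N : ℝ) / 2 - N * |β| * (4 * d)) ≤ 16 * N * ((d : ℝ) - 1) / szzBakryEmeryConstSU N d β :=
      div_le_div_of_nonneg_left hnum hKS hKSle
    refine szzPlaquetteSusceptibilityBound_sun hd hN hK hA (hA.trans ?_)
    exact div_le_div_of_nonneg_right (by nlinarith) hKS.le
  · exfalso
    have hd' : (2 : ℝ) ≤ d := by exact_mod_cast hd
    have hN' : (1 : ℝ) ≤ N := by exact_mod_cast hN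
    have hN2' : (N : ℝ) ≤ 2 := by exact_mod_cast hN2
    have hT : szzThresholdSO N d ≤ 0 := by
      simp only [szzThresholdSO]
      rw [sub_nonpos, one_div_le_one_div (by nlinarith) (by nlinarith)]
      nlinarith
    exact absurd (hβ.trans_le hT) (not_lt.2 (abs_nonneg β))

end Plaquettes

end Summit.QuantumFields.YangMills.Theorems.ColdStartUniversality

end
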